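import Summits.KontsevichZagierPeriods.KontsevichZagierPeriods.Theorems.SoloInformedBddMoves
import Summits.KontsevichZagierPeriods.KontsevichZagierPeriods.Theorems.SoloInformedTameMapSlackVolume
import Literature.NumberTheory.Transcendental.SemialgebraicMapsProofs
import HarnessLib

/-!
# Parametrised terms of a `KZ_ℝ` chain

The shallow embedding behind the kernel THEOREM R / THEOREM T (bounded chains): one TERM of a
formal combination of real integral representations, with all its real coefficients made into
parameters `p : K → ℝ`. A term `T : SoloInformedPTerm K d` (dimension `d`) is a `ℚ`-semialgebraic
DOMAIN FAMILY `T.S ⊆ ℝ^{K ⊕ d}`, a `ℚ`-semialgebraic GRAPH FAMILY `T.G ⊆ ℝ^{K ⊕ (d+1)}` and a fixed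
ambient function `T.φ : ℝ^d → ℝ` (the values of the integrand off the domain, which the calculus
never reads but the free abelian group does). At a parameter `p` the term denotes the representation
`T.rep p` with domain the fibre `T.fibre p = {x | (p, x) ∈ S}` and the HYBRID integrand
`T.hybrid p = (graph value on the fibre, φ off it)`, provided `p` is ADMISSIBLE
(`T.SoloInformedAdm p`: the graph fibre is functional over the domain fibre and both are bounded);
then `T.rep p` is a bounded representation (`bddRep_rep`), its fibres are `ℝ`-semialgebraic
(`soloInformed_isSemialgebraic_real_fibre`) and at parameters with `ℚ`-semialgebraic fibres it is the base change of a `ℚ`-representation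
(`ratRep`). Pull-back of terms along a map of parameter types (`pullback`) commutes with `rep`.

References: [cite: KontsevichZagier2001, §1.1–1.2]; [cite: BochnakCosteRoy1998, §2.2].
-/

noncomputable section

open Set MeasureTheory Literature.ModelTheory.ExponentialFields
  Literature.NumberTheory.Transcendental

namespace Summit.KontsevichZagierPeriods.KontsevichZagierPeriods.Theorems

/-- **A parametrised term**: dimension, `ℚ`-semialgebraic domain family over the parameter space
`ℝ^K`, `ℚ`-semialgebraic graph family (last coordinate = value), ambient integrand.
[cite: KontsevichZagier2001, §1.1] -/
structure SoloInformedPTerm (K : Type) (d : ℕ) where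
  /-- domain family: the domain at `p` is `{x | Sum.elim p x ∈ S}` -/
  S : Set (K ⊕ Fin d → ℝ)
  /-- graph family: the graph of the integrand over the domain at `p` is `{z | Sum.elim p z ∈ G}` -/
  G : Set (K ⊕ Fin (d + 1) → ℝ)
  /-- ambient integrand (values off the domain) -/
  φ : (Fin d → ℝ) → ℝ
  /-- the domain family is `ℚ`-semialgebraic -/
  hS : IsSemialgebraic ℚ S
  /-- the graph family is `ℚ`-semialgebraic -/
  hG : IsSemialgebraic ℚ G

namespace SoloInformedPTerm

variable {K K' : Type} {d : ℕ} (T : SoloInformedPTerm K d) (p : K → ℝ)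

/-- The domain at parameter `p`. [cite: BochnakCosteRoy1998, §2.2] -/
def fibre : Set (Fin d → ℝ) := {x | Sum.elim p x ∈ T.S}

/-- The graph at parameter `p` (a subset of `ℝ^{d+1}`, last coordinate = value).
[cite: BochnakCosteRoy1998, §2.2] -/
def gfibre : Set (Fin (d + 1) → ℝ) := {z | Sum.elim p z ∈ T.G}

/-- Membership in the domain fibre. [cite: BochnakCosteRoy1998, §2.2] -/
@[simp] theorem mem_fibre (x : Fin d → ℝ) : x ∈ T.fibre p ↔ Sum.elim p x ∈ T.S := Iff.rfl

/-- Membership in the graph fibre. [cite: BochnakCosteRoy1998, §2.2] -/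
@[simp] theorem mem_gfibre (z : Fin (d + 1) → ℝ) : z ∈ T.gfibre p ↔ Sum.elim p z ∈ T.G :=
  Iff.rfl

/-- The value read off the graph fibre (some `t` with `(x, t)` on the graph, if any).
[cite: BochnakCosteRoy1998, §2.2] -/
def gval (x : Fin d → ℝ) : ℝ := Classical.epsilon fun t : ℝ => Fin.snoc x t ∈ T.gfibre p

/-- The hybrid integrand at `p`: graph value on the fibre, ambient function off it.
[cite: KontsevichZagier2001, §1.1] -/
def hybrid (x : Fin d → ℝ) : ℝ := by
  classical exact if x ∈ T.fibre p then T.gval p x else T.φ x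

/-- The graph fibre is the graph of a function on the domain fibre.
[cite: BochnakCosteRoy1998, §2.2] -/
def SoloInformedFunctional (T : SoloInformedPTerm K d) (p : K → ℝ) : Prop :=
  ∀ x ∈ T.fibre p, (∃ t : ℝ, Fin.snoc x t ∈ T.gfibre p) ∧
    ∀ t t' : ℝ, Fin.snoc x t ∈ T.gfibre p → Fin.snoc x t' ∈ T.gfibre p → t = t'

/-- The domain fibre and the graph values over it are bounded. [cite: KontsevichZagier2001, §1.1] -/
def SoloInformedBounded (T : SoloInformedPTerm K d) (p : K → ℝ) : Prop :=
  ∃ M : ℝ, (∀ x ∈ T.fibre p, ∀ i, |x i| ≤ M) ∧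
    ∀ x ∈ T.fibre p, ∀ t : ℝ, Fin.snoc x t ∈ T.gfibre p → |t| ≤ M

/-- Admissible parameter: functional graph and bounded data. [cite: KontsevichZagier2001, §1.1] -/
def SoloInformedAdm (T : SoloInformedPTerm K d) (p : K → ℝ) : Prop :=
  T.SoloInformedFunctional p ∧ T.SoloInformedBounded p

variable {T p}

/-- The chosen value lies on the graph whenever some value does.
[cite: BochnakCosteRoy1998, §2.2] -/
theorem gval_spec {x : Fin d → ℝ} (h : ∃ t : ℝ, Fin.snoc x t ∈ T.gfibre p) :
    Fin.snoc x (T.gval p x) ∈ T.gfibre p :=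
  Classical.epsilon_spec h

/-- On a functional fibre the graph value is the unique point of the graph over `x`.
[cite: BochnakCosteRoy1998, §2.2] -/
theorem gval_eq (hf : T.SoloInformedFunctional p) {x : Fin d → ℝ} (hx : x ∈ T.fibre p) {t : ℝ}
    (ht : Fin.snoc x t ∈ T.gfibre p) : T.gval p x = t :=
  (hf x hx).2 _ _ (gval_spec ⟨t, ht⟩) ht

/-- On a functional fibre, `(x, gval x)` is on the graph. [cite: BochnakCosteRoy1998, §2.2] -/
theorem snoc_gval_mem (hf : T.SoloInformedFunctional p) {x : Fin d → ℝ} (hx : x ∈ T.fibre p) :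
    Fin.snoc x (T.gval p x) ∈ T.gfibre p :=
  gval_spec (hf x hx).1

/-- The hybrid integrand on the fibre. [cite: KontsevichZagier2001, §1.1] -/
theorem hybrid_of_mem {x : Fin d → ℝ} (hx : x ∈ T.fibre p) : T.hybrid p x = T.gval p x := by
  unfold hybrid
  exact if_pos hx

/-- The hybrid integrand off the fibre. [cite: KontsevichZagier2001, §1.1] -/
theorem hybrid_of_not_mem {x : Fin d → ℝ} (hx : x ∉ T.fibre p) : T.hybrid p x = T.φ x := by
  unfold hybrid
  exact if_neg hx

/-- The hybrid integrand equals any function whose graph over the fibre is the graph fibre, on the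
fibre. [cite: KontsevichZagier2001, §1.1] -/
theorem hybrid_eq_of_mem (hf : T.SoloInformedFunctional p) {x : Fin d → ℝ} (hx : x ∈ T.fibre p)
    {t : ℝ} (ht : Fin.snoc x t ∈ T.gfibre p) : T.hybrid p x = t := by
  rw [hybrid_of_mem hx, gval_eq hf hx ht]

variable (T p)

/-- The domain fibre is `ℝ`-semialgebraic. [cite: BochnakCosteRoy1998, §2.2] -/
theorem isSemialgebraic_fibre : IsSemialgebraic ℝ (T.fibre p) :=
  soloInformed_isSemialgebraic_real_fibre T.hS p

/-- The graph fibre is `ℝ`-semialgebraic. [cite: BochnakCosteRoy1998, §2.2] -/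
theorem isSemialgebraic_gfibre : IsSemialgebraic ℝ (T.gfibre p) :=
  soloInformed_isSemialgebraic_real_fibre T.hG p

/-- The domain fibre is Lebesgue measurable. [cite: BochnakCosteRoy1998, §2.2] -/
theorem measurableSet_fibre : MeasurableSet (T.fibre p) :=
  IsSemialgebraic.measurableSet_holds (T.isSemialgebraic_fibre p)

variable {T p}

/-- On a functional fibre, the graph of the hybrid integrand over the fibre is the graph fibre cut
to the fibre. [cite: BochnakCosteRoy1998, §2.2] -/
theorem graph_hybrid_eq (hf : T.SoloInformedFunctional p) :
    {z : Fin (d + 1) → ℝ | Fin.init z ∈ T.fibre p ∧ z (Fin.last d) = T.hybrid p (Fin.init z)} =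
      T.gfibre p ∩ {z | Fin.init z ∈ T.fibre p} := by
  ext z
  simp only [mem_setOf_eq, mem_inter_iff]
  constructor
  · rintro ⟨hx, hz⟩
    refine ⟨?_, hx⟩
    have h := snoc_gval_mem hf hx
    rwa [← hybrid_of_mem hx, ← hz, Fin.snoc_init_self] at h
  · rintro ⟨hz, hx⟩
    refine ⟨hx, (hybrid_eq_of_mem hf hx (t := z (Fin.last d)) ?_).symm⟩
    rwa [Fin.snoc_init_self]

/-- On a functional fibre with `k`-semialgebraic fibres, the hybrid integrand is a `k`-semialgebraic
function on the domain fibre. [cite: BochnakCosteRoy1998, §2.2] -/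
theorem isSemialgebraicFunOn_hybrid_of {k : Type*} [CommRing k] [Algebra k ℝ]
    (hS : IsSemialgebraic k (T.fibre p)) (hG : IsSemialgebraic k (T.gfibre p))
    (hf : T.SoloInformedFunctional p) : IsSemialgebraicFunOn k (T.fibre p) (T.hybrid p) := by
  rw [isSemialgebraicFunOn_iff, graph_hybrid_eq hf]
  exact hG.inter hS.setOf_init_mem

/-- On a functional fibre the hybrid integrand is an `ℝ`-semialgebraic function on the fibre.
[cite: BochnakCosteRoy1998, §2.2] -/
theorem isSemialgebraicFunOn_hybrid (hf : T.SoloInformedFunctional p) :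
    IsSemialgebraicFunOn ℝ (T.fibre p) (T.hybrid p) :=
  isSemialgebraicFunOn_hybrid_of (T.isSemialgebraic_fibre p) (T.isSemialgebraic_gfibre p) hf

/-- A bound for the hybrid integrand on a bounded functional fibre.
[cite: KontsevichZagier2001, §1.1] -/
theorem abs_hybrid_le (hf : T.SoloInformedFunctional p) {M : ℝ}
    (hM : ∀ x ∈ T.fibre p, ∀ t : ℝ, Fin.snoc x t ∈ T.gfibre p → |t| ≤ M)
    {x : Fin d → ℝ} (hx : x ∈ T.fibre p) : |T.hybrid p x| ≤ M := by
  rw [hybrid_of_mem hx]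
  exact hM x hx _ (snoc_gval_mem hf hx)

/-- A set inside a coordinate box has finite volume. [cite: EvansGariepy1992, §1.1] -/
theorem volume_lt_top_of_forall_abs_le {d : ℕ} {s : Set (Fin d → ℝ)} {M : ℝ}
    (hM : ∀ x ∈ s, ∀ i, |x i| ≤ M) : volume s < ⊤ := by
  have hsub : s ⊆ Set.pi univ fun _ : Fin d => Icc (-M) M := fun x hx i _ =>
    ⟨neg_le_of_abs_le (hM x hx i), le_of_abs_le (hM x hx i)⟩
  refine (measure_mono hsub).trans_lt ?_
  rw [volume_pi_pi]
  exact ENNReal.prod_lt_top fun i _ => by simp [Real.volume_Icc]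

/-- At an admissible parameter the hybrid integrand is absolutely integrable on the fibre (bounded
measurable function on a bounded measurable set). [cite: KontsevichZagier2001, §1.1] -/
theorem integrableOn_hybrid (h : T.SoloInformedAdm p) : IntegrableOn (T.hybrid p) (T.fibre p) := by
  obtain ⟨M, hM₁, hM₂⟩ := h.2
  have hmeas : Measurable ((T.fibre p).restrict (T.hybrid p)) :=
    IsSemialgebraicFunOn.measurable_holds (isSemialgebraicFunOn_hybrid h.1)
  refine IntegrableOn.of_bound (volume_lt_top_of_forall_abs_le hM₁)
    (aemeasurable_restrict_of_measurable_subtype (T.measurableSet_fibre p)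
      hmeas).aestronglyMeasurable M ?_
  rw [ae_restrict_iff' (T.measurableSet_fibre p)]
  exact Filter.Eventually.of_forall fun x hx => by
    rw [Real.norm_eq_abs]
    exact abs_hybrid_le h.1 hM₂ hx

/-- The junk representation (empty domain) used at inadmissible parameters.
[cite: KontsevichZagier2001, §1.1] -/
def junkRep (T : SoloInformedPTerm K d) : KZOver.IntegralRep ℝ d where
  domain := ∅
  integrand := T.φ
  isSemialgebraic_domain := isSemialgebraic_empty
  isSemialgebraicFunOn_integrand := by
    rw [isSemialgebraicFunOn_iff]
    convert (isSemialgebraic_empty : IsSemialgebraic ℝ (∅ : Set (Fin (d + 1) → ℝ))) using 1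
    ext z
    simp
  integrableOn := integrableOn_empty

variable (T p)

/-- **The representation denoted by the term at parameter `p`** (the junk representation if `p`
is not admissible). [cite: KontsevichZagier2001, §1.1] -/
def rep : KZOver.IntegralRep ℝ d := by
  classical
  exact if h : T.SoloInformedAdm p then
    { domain := T.fibre p
      integrand := T.hybrid p
      isSemialgebraic_domain := T.isSemialgebraic_fibre p
      isSemialgebraicFunOn_integrand := isSemialgebraicFunOn_hybrid h.1
      integrableOn := integrableOn_hybrid h }
  else T.junkRep

variable {T p}

/-- Domain of the denoted representation at an admissible parameter.
[cite: KontsevichZagier2001, §1.1] -/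
theorem rep_domain (h : T.SoloInformedAdm p) : (T.rep p).domain = T.fibre p := by
  unfold rep
  rw [dif_pos h]

/-- Integrand of the denoted representation at an admissible parameter.
[cite: KontsevichZagier2001, §1.1] -/
theorem rep_integrand (h : T.SoloInformedAdm p) : (T.rep p).integrand = T.hybrid p := by
  unfold rep
  rw [dif_pos h]

/-- The denoted representation at an inadmissible parameter. [cite: KontsevichZagier2001, §1.1] -/
theorem rep_of_not_adm (h : ¬ T.SoloInformedAdm p) : T.rep p = T.junkRep := by
  unfold rep
  rw [dif_neg h]

/-- At an admissible parameter the denoted representation is bounded.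
[cite: KontsevichZagier2001, §1.1] -/
theorem bddRep_rep (h : T.SoloInformedAdm p) : SoloInformedBddRep (T.rep p) := by
  obtain ⟨M, hM₁, hM₂⟩ := h.2
  refine ⟨M, fun x hx => hM₁ x (by rwa [rep_domain h] at hx), fun x hx => ?_⟩
  rw [rep_domain h] at hx
  rw [rep_integrand h]
  exact abs_hybrid_le h.1 hM₂ hx

/-- A representation is denoted by the term at `p` as soon as its domain is the fibre and the graph
of its integrand over the domain is the graph fibre (then `p` is functional; boundedness is
assumed). [cite: KontsevichZagier2001, §1.1] -/
theorem rep_eq_of_graph (r : KZOver.IntegralRep ℝ d) (hdom : r.domain = T.fibre p)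
    (hgraph : ∀ x ∈ T.fibre p, ∀ t : ℝ, Fin.snoc x t ∈ T.gfibre p ↔ t = r.integrand x)
    (hφ : ∀ x ∉ T.fibre p, T.φ x = r.integrand x) (hb : T.SoloInformedBounded p) : T.rep p = r := by
  have hf : T.SoloInformedFunctional p := fun x hx =>
    ⟨⟨r.integrand x, (hgraph x hx _).2 rfl⟩, fun t t' ht ht' => by
      rw [(hgraph x hx t).1 ht, (hgraph x hx t').1 ht']⟩
  have h : T.SoloInformedAdm p := ⟨hf, hb⟩
  refine KZOver.IntegralRep.ext (by rw [rep_domain h, hdom]) ?_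
  rw [rep_integrand h]
  funext x
  by_cases hx : x ∈ T.fibre p
  · exact hybrid_eq_of_mem hf hx ((hgraph x hx _).2 rfl)
  · rw [hybrid_of_not_mem hx, hφ x hx]

/-- **Rational parameters.** If the fibres at `p` are `ℚ`-semialgebraic and `p` is admissible, the
denoted representation is the base change of a `ℚ`-representation with the same domain and
integrand. [cite: KontsevichZagier2001, §1.1] -/
def ratRep (hS : IsSemialgebraic ℚ (T.fibre p)) (hG : IsSemialgebraic ℚ (T.gfibre p))
    (h : T.SoloInformedAdm p) : KZOver.IntegralRep ℚ d where
  domain := T.fibre p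
  integrand := T.hybrid p
  isSemialgebraic_domain := hS
  isSemialgebraicFunOn_integrand := isSemialgebraicFunOn_hybrid_of hS hG h.1
  integrableOn := integrableOn_hybrid h

/-- The base change to `ℝ` of the rational representation is the denoted representation.
[cite: KontsevichZagier2001, §1.1] -/
theorem baseChange_ratRep (hS : IsSemialgebraic ℚ (T.fibre p)) (hG : IsSemialgebraic ℚ (T.gfibre p))
    (h : T.SoloInformedAdm p) : (ratRep hS hG h).baseChange ℝ = T.rep p :=
  KZOver.IntegralRep.ext (by rw [rep_domain h]; rfl) (by rw [rep_integrand h]; rfl)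

/-! ### Pull-back along a map of parameter types -/

/-- Reindexing `(K ⊕ β) → (K' ⊕ β)` along `θ : K → K'`. [cite: BochnakCosteRoy1998, §2.2] -/
theorem sumElim_comp_sumMap (θ : K → K') {β : Type} (p' : K' → ℝ) (x : β → ℝ) :
    Sum.elim p' x ∘ Sum.map θ id = Sum.elim (p' ∘ θ) x := by
  rw [Sum.elim_comp_map, Function.comp_id]

variable (T)

/-- **Pull-back of a term** along `θ : K → K'` (new parameters `p'`, old parameters `p' ∘ θ`).
[cite: BochnakCosteRoy1998, §2.2] -/
def pullback (θ : K → K') : SoloInformedPTerm K' d where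
  S := {w | w ∘ Sum.map θ id ∈ T.S}
  G := {w | w ∘ Sum.map θ id ∈ T.G}
  φ := T.φ
  hS := T.hS.preimage_comp _
  hG := T.hG.preimage_comp _

variable (θ : K → K') (p' : K' → ℝ)

/-- Fibres of the pull-back. [cite: BochnakCosteRoy1998, §2.2] -/
@[simp] theorem fibre_pullback : (T.pullback θ).fibre p' = T.fibre (p' ∘ θ) := by
  ext x
  show Sum.elim p' x ∘ Sum.map θ id ∈ T.S ↔ Sum.elim (p' ∘ θ) x ∈ T.S
  rw [sumElim_comp_sumMap]

/-- Graph fibres of the pull-back. [cite: BochnakCosteRoy1998, §2.2] -/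
@[simp] theorem gfibre_pullback : (T.pullback θ).gfibre p' = T.gfibre (p' ∘ θ) := by
  ext z
  show Sum.elim p' z ∘ Sum.map θ id ∈ T.G ↔ Sum.elim (p' ∘ θ) z ∈ T.G
  rw [sumElim_comp_sumMap]

/-- Graph values of the pull-back. [cite: BochnakCosteRoy1998, §2.2] -/
@[simp] theorem gval_pullback : (T.pullback θ).gval p' = T.gval (p' ∘ θ) := by
  funext x
  simp only [gval, gfibre_pullback]

/-- Hybrid integrands of the pull-back. [cite: KontsevichZagier2001, §1.1] -/
@[simp] theorem hybrid_pullback : (T.pullback θ).hybrid p' = T.hybrid (p' ∘ θ) := by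
  funext x
  by_cases hx : x ∈ T.fibre (p' ∘ θ)
  · rw [hybrid_of_mem hx, hybrid_of_mem (by simpa using hx), gval_pullback]
  · rw [hybrid_of_not_mem hx, hybrid_of_not_mem (by simpa using hx)]
    rfl

/-- Functionality is invariant under pull-back. [cite: BochnakCosteRoy1998, §2.2] -/
theorem functional_pullback_iff :
    (T.pullback θ).SoloInformedFunctional p' ↔ T.SoloInformedFunctional (p' ∘ θ) := by
  simp only [SoloInformedFunctional, fibre_pullback, gfibre_pullback]

/-- Boundedness is invariant under pull-back. [cite: KontsevichZagier2001, §1.1] -/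
theorem bounded_pullback_iff :
    (T.pullback θ).SoloInformedBounded p' ↔ T.SoloInformedBounded (p' ∘ θ) := by
  simp only [SoloInformedBounded, fibre_pullback, gfibre_pullback]

/-- Admissibility is invariant under pull-back. [cite: KontsevichZagier2001, §1.1] -/
theorem adm_pullback_iff : (T.pullback θ).SoloInformedAdm p' ↔ T.SoloInformedAdm (p' ∘ θ) := by
  rw [SoloInformedAdm, SoloInformedAdm, functional_pullback_iff, bounded_pullback_iff]

/-- **The denoted representation is invariant under pull-back.**
[cite: KontsevichZagier2001, §1.1] -/
theorem rep_pullback : (T.pullback θ).rep p' = T.rep (p' ∘ θ) := by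
  by_cases h : T.SoloInformedAdm (p' ∘ θ)
  · have h' : (T.pullback θ).SoloInformedAdm p' := (adm_pullback_iff T θ p').2 h
    exact KZOver.IntegralRep.ext (by rw [rep_domain h', rep_domain h, fibre_pullback])
      (by rw [rep_integrand h', rep_integrand h, hybrid_pullback])
  · have h' : ¬ (T.pullback θ).SoloInformedAdm p' := fun h' => h ((adm_pullback_iff T θ p').1 h')
    rw [rep_of_not_adm h', rep_of_not_adm h]
    rfl

end SoloInformedPTerm

end Summit.KontsevichZagierPeriods.KontsevichZagierPeriods.Theorems
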